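import Literature.MathematicalPhysics.QuantumFieldTheory.Balaban1983to89.B15Layer130Lattice

/-!
# `Balaban1983to89.B14ArgField36Lattice` — T. Bałaban, *Convergent renormalization expansions for lattice gauge theories*,
# Commun. Math. Phys. **119** (1988) 243–285 [Balaban1988Convergent] ("[III]"), p. 266, the two sentences after (3.6):
# *"On almost the whole cube □^{∼4}, except a boundary layer of the width 2M₁, the field in the argument of the function
# 𝐇_{k,□} is equal to (1/i)log[V_k(V_{□′}^{(k)})⁻¹], hence it can be bounded by 4δ_k. On the boundary layer this field can
# be bounded by 30d²L²B₃(1+β₀)ε_k by an application of the inequality (1.65) from [14], or rather by an application of the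
# reasoning leading to that inequality"* — the two located SIZES of the argument field of (3.6), PROVED on the `ℤ^d` carriers
# (the (1.65)-reasoning with top discrepancy `2δ_k` from (3.3), sibling file `B15Layer130Lattice`), and the TWIN PASSAGE of
# [IV] = [Balaban1989LargeFieldI] p. 185–186 (the sizes `4δ′_j`, `22d²ε_j`, `22d²ε_{j+1}` of the (1.34)/(1.38) argument field from
# (1.27), and the `4δ′_j` of (1.44)/(1.45))

statement-level skeleton of published theorems with citation tags; proofs where landed; nothing here is a claim about the Yang–Mills mass gap

PDF held: `paper:balaban1988-cmp119-convergent-renormalization` (journal page = PDF page + 242; pp. 256, 265–266 = PDF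
pp. 14, 23–24, READ AS IMAGES on the x2 renders `run/shared/lean/pub/pub-balaban/b2b-balaban-ref1/pages/1988-cmp119-
convergent-renormalization/…-p014,p023,p024-x2.png`).  "[14]" = [Balaban1985RegularSpaces] (1.65) p. 87 (tree:
`B8Ineq165Descent.descent_bg`, p26); "[12]" = [Balaban1985Averaging] (26) p. 22 (`MatrixLog.norm_mlog_le_two_mul`), (8)/(45)
(`B7AvgGaugeCovariance.norm_conj_sub_one_eq`).

WHAT IS REPRODUCED (mega-formalization `lit-balaban`, HOME `run/shared/lean/pub/lit-balaban/`, Phase-2 proof seat p29,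
generation 7, free-target protocol G.5-34(d); SKELETON row **B14.Claim@265** (reader/fold owner r11, referee ref-5): the
two located inputs `4δ_k` (bulk) and `30d²L²B₃(1+β₀)ε_k` (boundary layer) of the first member of (3.7) — in the tree they
are the B-size HYPOTHESES `hm₁`/`hm₂` of r11's `B14Ineq38From190.ineq37_first_of_ineq190` (r11 g7, p262722: (3.7) from [15]
(190), (3.8) end-to-end) exactly as r12's `hm` in `B15Ineq131Input`; THIS FILE certifies the two numbers at the lattice
level (the BlockNorm ↔ lattice dictionary is not built here, as in all `…From190` files).  The (1.65)-reasoning itself is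
the sibling file `B15Layer130Lattice` (p29 g7, p263483: `norm_argField_le` with a top discrepancy `α₁`); here `α₁ = 2δ_k`.
§2: the same two theorems serve the twin passage [IV] p. 185–186 — SKELETON rows **B15.Eq1.38** (the three B-sizes `4δ′_j`,
`22d²ε_{j+1}`, `22d²ε_j` = the hypotheses `hm₁`/`hm₂`/`hm₃` of r12's `B15HDecayLeaves.ineq138_first_of_ineq190`), **B15.Eq1.45**
(the B-size `4δ′_j` = `hm` of r12's `ineq145_of_ineq190`) and **B15.Eq1.34–1.36** (the p. 185 sentences on the argument of
(1.34)); owner r12.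

THE PRINTED TEXT (p. 265–266 [PDF 23–24], verbatim).  *"1 = Σ_{Q_{k+1}} Π_{□′⊂Q^c_{k+1}} χ({sup_{b∈(□′^{∼2})^{(k)*}} |V_k(b)
(V^{(k)}_{□′}(b))⁻¹ − 1| < 2δ_k}) Π_{□′⊂Q_{k+1}} χ({… ≧ 2δ_k}) = … (3.3) … The configuration V^{(k)}_{□′} is defined on
(□′^∼)^{(k)} by V^{(k)}_{□′} = M^k(U_{k+1,□′}), (3.4) and δ_k = g_kA₁/A₀p₀(g_k). … Take χ_k(□) for a cube □ ⊂ Ω^∼_{k+1}. This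
cube determines a cube □′ of the next partition, such that □ ⊂ □′ ⊂ Ω^∼_{k+1}. For the function U_{k,□} we have U_{k,□} =
U(𝐁_k(□^{∼4}), [M˙(Q_k^{s*}V_k)(M˙(U_{k+1,□′}))⁻¹]M˙(U_{k+1,□′})) = (exp iη𝐇_{k,□}((1/i)log[M˙(Q_k^{s*}V_k)(M˙(U_{k+1,□′}))⁻¹])
U_{k+1,□′})^{u⁻¹_{k,□}}. (3.6) On almost the whole cube □^{∼4}, except a boundary layer of the width 2M₁, the field in
the argument of the function 𝐇_{k,□} is equal to (1/i)log[V_k(V_{□′}^{(k)})⁻¹], hence it can be bounded by 4δ_k. On the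
boundary layer this field can be bounded by 30d²L²B₃(1+β₀)ε_k by an application of the inequality (1.65) from [14],
or rather by an application of the reasoning leading to that inequality."*; (3.2) p. 265: *"sup_{p⊂□′^∼} |U_{k+1,□′}(∂p) −
1| < ε_{k+1}(L⁻¹η)²"*; (2.8) p. 256: *"ε_n ≦ (1+β₀)(n−m)^{1/2}ε_m"*; p. 266: *"for A₁/A₀ and γ sufficiently small"*; the
determining set `𝐁_k(□^{∼4})`, p. 256: *"dist(Ω_j, Ω^c) ≦ 2M₁, or Ω^{∼−2} ⊂ Ω_j"*, (2.11) *"M_𝐁(U) = M^j(U) on Γ_j"*.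
[IV] p. 185 [PDF 11], verbatim: *"Consider now the field in the argument of the function ℍ. On the domain Ω_{j+1}∩Z_{j+1},
except a boundary layer of the width 2LM₁ at the boundary ∂Z_{j+1}, this field is equal to 0. On the boundary layer it can be
bounded by 22d²ε_{j+1}. Similarly, on the domain Ω^c_j∩Z^c_j, except a boundary layer of the width 2M₁ at the boundary ∂Z^c_j,
the field is equal to (1/i)log[V_j(V_Z^{(j)})⁻¹], hence it can be bounded by 4δ′_j, as it follows from the restrictions in
(1.27). On the boundary layer it can be bounded by 22d²ε_j."*; (1.27) p. 182: *"χ′_j = χ({|V_j(b)(V_Z^{(j)}(b))⁻¹ − 1| < 2δ′_j for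
b ∈ (Ω^c_{j+1}∖Z″_{j+1})^{(j)*}})"*; (1.26): *"V_Z^{(j)} = M^j(U^{(j+1−h)}_{k,Z})"*; p. 184: *"the configuration Q^{s*}V is equal to
Q^{s*}_{j+1}V_{j+1} on Ω_{j+1}∩Z_{j+1}, and to Q^{s*}_jV_j on Ω^c_{j+1}∩Z^c_j"*, *"From the restrictions (1.27) we get the bound
O(1)δ′_j < ε_j"*; (1.44)–(1.45) p. 186: *"U^{(n)}_{k,Z} = (exp iηℍ^{(n)}_{k,Z}((1/i)log[V_j(V_Z^{(j)})⁻¹]) U^{(n+1)}_{k,Z})^{u⁻¹}.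
(1.44) … The field in the argument of the function ℍ^{(n)}_k is bounded by 4δ′_j"*.

THE PROOF (print's, unfolded).  The argument field at depth `n` on the determining set is `(1/i)log[(Q^{s*}_nV_k)(b)·
(M^{k−n}(U_{k+1,□′})(b))⁻¹]` (`M_𝐁 = M^{k−n}` on the depth-`n` component, (2.11); `M^{k−n}(Q_k^{s*}V_k) = Q^{s*}_nV_k`, the
section property `B15Ineq184BlockAxial.bavg_pull`).  TOP (`n = 0`, the component `Ω_k ⊃ (□^{∼4})^{∼−2}`): `(1/i)log[V_k(b)
(V^{(k)}_{□′}(b))⁻¹]` by (3.4); `< 2·2δ_k = 4δ_k` by (3.3) and (26) of [12] (`argField36_top_lt`).  LAYER (`n ≥ 1`):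
`B15Layer130Lattice.norm_argField_le` with top discrepancy `α₁ = 2δ_k` ((3.3) ⇒ `|M^k(U)(b) − V_k(b)| ≤ 2δ_k`,
`top_sub_le_of_eq33`) and fine plaquettes `α = ε_{k+1}L⁻²` ((3.2), `η = L^{−k}`): `< 4δ_k + 22d²ε_{k+1}L⁻²` (`argField36_lt`);
with (2.8), `δ_k ≤ ε_k` (*"A₁/A₀ … small"*: `δ_k = (A₁/A₀)ε_k`, p. 265), `B₃ ≥ 1`, `β₀ ≥ 0`: `4δ_k + 22d²ε_{k+1}L⁻² ≤
8d²L²B₃(1+β₀)ε_k + 22d²L²B₃(1+β₀)ε_k = 30d²L²B₃(1+β₀)ε_k` — print's number (`argField36_lt_printed`); FOR EVERY ORBIT: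
the block-axial gauge exists ([14] p. 78, `B8Eq115GaugeFixing.gaugeFix_global`), (3.2) and (3.3) are invariant under the
simultaneous transformation (`pdev_gaugeAct`, `norm_ratio_gaugeAct_sub_one`, [12] (14) `M^k(U^u) = M^k(U)^{u↾T^{(k)}}`), and
the bound holds for that representative — in (3.6) the compensating transformation is absorbed in `u_{k,□}`
(`argField36_lt_printed_orbit`).  §2 ([IV] p. 185–186): `argField145_lt` = the top step with `δ′_j` ((1.27)); `layer138_Zc_lt` =
`norm_argField_le` with `α₁ = 2δ′_j`, `α = ε_j` ((1.24), c = 1): `≤ 4δ′_j + (64/3)d²ε_j ≤ 22d²ε_j` under `6δ′_j ≤ ε_j` (p. 184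
*"O(1)δ′_j < ε_j"*); `layer138_Z_lt` = `B15Layer130Lattice.argField_top_eq_zero`/`layer130_lt` one scale up.

DICTIONARY / HONEST SCOPE (as in `B15Layer130Lattice`, header there).  (1) `ℤ^d` carriers, `AvgClosed` value group `G ≤
U1 𝔸` (`U(N)`, `SU(N)`), (3.2) in the global sup form `pdev U < ε_{k+1}(L⁻¹η)²`, `η = L^{−k}`, the axial gauge in blocks on
the cube tower below `(□^{∼4})^{(k)} ⊂ [lo, hi]` (or the orbit representative), `M˙` componentwise at face value — the
theorems hold on the WHOLE cube tower, a superset of the components of `𝐁_k(□^{∼4})`; that the lower components lie within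
`2M₁` of `∂□^{∼4}` is [III] p. 256 (row B14.Eq2.13), not restated.  (2) (3.3) is assumed on EVERY bond of the top cube;
print's supremum runs over `(□′^{∼2})^{(k)*}`, the star removing the bonds `b₀(c)` of (1.9) — on those the `4δ_k` is the
object of the cell's located objection GAPS.md C-adv5-92 (b) (`B14Sect3.ineq37_coeff_conclusion`), which this file does
not resolve: `argField36_top_lt` is per bond, from (3.3) at that bond; likewise (1.27)'s star `(…)^{(j)*}` for `argField145_lt`
/ `layer138_Zc_lt`.  (3) `30d²L²B₃(1+β₀)ε_k` is obtained as an UPPER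
bound of the derived `4δ_k + 22d²ε_{k+1}L⁻²`; no sharper genesis of print's `30` is claimed; the smallness hypotheses are
stated on `ε_{k+1}` (`C₀ε_{k+1} ≤ ⅓`, `2ε_{k+1} ≤ c₂′`, `2δ_k + 11d²ε_{k+1} ≤ 1/6`, stronger than the `ε_{k+1}L⁻²`-forms used).
(4) `(1/i)log` = the series (21) of [12] `MatrixLog.mlog` (the `1/i` dropped: same norm).  Every declaration is a proved
theorem; no `def`, no new `Prop` fact; standard axioms.  Unit `lit-balaban-p29` (literature-prover-lit-balaban-p29-g7-0).
-/

noncomputable section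

open scoped BigOperators
open NormedSpace Finset

namespace Literature.MathematicalPhysics.QuantumFieldTheory.Balaban1983to89.B14ArgField36Lattice

open MatrixLog B7Prop1Explicit B7Prop2Explicit B8Lemma1NonAbelian B8Ineq129 B8Ineq130 B8Ineq165Descent
  B15Ineq184BlockAxial B7AvgGaugeCovariance B8Eq115GaugeFixing B15Layer130Lattice

-- `Site` alone would resolve to the torus sites of `Setup.lean`; re-export the `ℤ^d` sites of `B7Prop1Explicit`.
export B7Prop1Explicit (Site)

variable {d : ℕ}

/-! ## §1 [III] (3.6) p. 266, the ARGUMENT FIELD on the lattice: top discrepancy `2δ_k` from (3.3) — *"hence it can be bounded by 4δ_k. On the boundary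
layer this field can be bounded by 30d²L²B₃(1+β₀)ε_k"* -/

section Eq36

variable {𝔸 : Type*} [NormedRing 𝔸] [NormOneClass 𝔸] [NormedAlgebra ℂ 𝔸] [CompleteSpace 𝔸]

omit [NormedAlgebra ℂ 𝔸] [CompleteSpace 𝔸] in
/-- (3.3) in the form the descent consumes: `|V_k(b)(V_{□′}^{(k)}(b))⁻¹ − 1| < 2δ_k` with `V_{□′}^{(k)} = M^k(U_{k+1,□′})`
unit-norm-valued gives `|M^k(U)(b) − V_k(b)| ≤ 2δ_k` ([14] (1.65): `|p − q| = |pq⁻¹ − 1|`).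
[cite: Balaban1988Convergent, (3.3) p.265] -/
theorem top_sub_le_of_eq33 {A V : 𝔸ˣ} (hA : A ∈ U1 𝔸) {δk : ℝ}
    (h33 : ‖((V * A⁻¹ : 𝔸ˣ) : 𝔸) - 1‖ < 2 * δk) : ‖(A : 𝔸) - V‖ ≤ 2 * δk := by
  rw [norm_sub_rev, norm_sub_eq_norm_pert hA]; exact h33.le

omit [NormOneClass 𝔸] in
/-- **[III] p. 266, "On almost the whole cube □^{∼4}, except a boundary layer of the width 2M₁, the field in the
argument of the function 𝐇_{k,□} is equal to (1/i)log[V_k(V_{□′}^{(k)})⁻¹], hence it can be bounded by 4δ_k"**: at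
the top level of `𝐁_k(□^{∼4})`, `M˙(Q_k^{s*}V_k) = V_k` and `M˙(U_{k+1,□′}) = M^k(U_{k+1,□′}) = V_{□′}^{(k)}` ((3.4)), and
(3.3) `|V_k(b)(V_{□′}^{(k)}(b))⁻¹ − 1| < 2δ_k` with (26) of [12] gives `|(1/i)log[V_k(b)(V_{□′}^{(k)}(b))⁻¹]| < 4δ_k`
(for `2δ_k ≤ ½`).  HONEST SCOPE: (3.3) is taken on the bond in question; print's supremum in (3.3) runs over
`(□′^{∼2})^{(k)*}`, the star excluding the bonds `b₀(c)` of (1.9) — on those the `4δ_k` is the object of the cell's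
located objection GAPS.md C-adv5-92 (b), which this theorem does not touch. [cite: Balaban1988Convergent, p.266 (after (3.6))] -/
theorem argField36_top_lt (A V : 𝔸ˣ) {δk : ℝ} (hδ : 2 * δk ≤ 1 / 2)
    (h33 : ‖((V * A⁻¹ : 𝔸ˣ) : 𝔸) - 1‖ < 2 * δk) : ‖mlog (((V * A⁻¹ : 𝔸ˣ) : 𝔸))‖ < 4 * δk := by
  have h0 : 0 ≤ ‖((V * A⁻¹ : 𝔸ˣ) : 𝔸) - 1‖ := norm_nonneg _
  have h := norm_mlog_le_two_mul (X := ((V * A⁻¹ : 𝔸ˣ) : 𝔸)) (by linarith)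
  by_cases hz : ‖((V * A⁻¹ : 𝔸ˣ) : 𝔸) - 1‖ = 0
  · rw [hz, mul_zero] at h
    have : (0 : ℝ) < 4 * δk := by linarith
    linarith
  · have hpos : 0 < ‖((V * A⁻¹ : 𝔸ˣ) : 𝔸) - 1‖ := lt_of_le_of_ne h0 (Ne.symm hz)
    linarith

/-- **[III] p. 266, "On the boundary layer this field can be bounded by 30d²L²B₃(1+β₀)ε_k by an application of the
inequality (1.65) from [14], or rather by an application of the reasoning leading to that inequality" — DERIVED FORM.**
On the `ℤ^d` carriers: `U = U_{k+1,□′}` (`G`-valued, fine plaquettes `|U(∂p) − 1| < αη²`, `η = L^{−k}`, global sup form,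
`α` Prop.-1/2-small; in the axial gauge in blocks on the cube tower below `[lo, hi]`), `V = V_k` unit-norm-valued with
(3.3) on every bond of `[lo, hi]` (`V_{□′}^{(k)} = M^k(U)`, (3.4)), `2δ_k + 11d²α ≤ 1/6`; then at every depth `n ≤ k`
and bond `b` of the depth-`n` cube the argument field `(1/i)log[(Q_k^{s*}V_k)^{(k−n)}(b)(M^{k−n}(U)(b))⁻¹]`
(`(Q_k^{s*}V_k)^{(k−n)} = Q^{s*}_nV_k`, the section property) is bounded by `2(2δ_k + 8d²α(L^{−2(n−1)} + … + 1)) <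
4δ_k + 22d²α` — the descent with top discrepancy `α₁ = 2δ_k`. [cite: Balaban1988Convergent, p.266 (after (3.6))] -/
theorem argField36_lt (L : ℕ) (hL : 2 ≤ L) (hd : 1 ≤ d) {G : Subgroup 𝔸ˣ} (hG : AvgClosed d L G)
    (k : ℕ) (U : Site d → Fin d → 𝔸ˣ) (hU : ∀ x κ, U x κ ∈ G) {α : ℝ} (hα : 0 < α) (hα3 : C0 d * α ≤ 1 / 3)
    (hα2 : 2 * α ≤ c2' d L) (h32 : pdev U < α * (((L : ℝ) ^ k)⁻¹) ^ 2)
    (V : Site d → Fin d → 𝔸ˣ) (hV : ∀ x μ, V x μ ∈ U1 𝔸) {δk : ℝ} (hδ : 0 ≤ δk)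
    (hs : 2 * δk + 11 * (d : ℝ) ^ 2 * α ≤ 1 / 6) (lo hi : Site d)
    (h15 : ∀ n, n < k → ∀ z, tlo L lo n ≤ z → z ≤ thi L hi n → ∀ r : Fin d → Fin L,
      axialFn (avgIter L U (k - (n + 1))) ((L : ℤ) • z) ((L : ℤ) • z + boxVec L r) = 1)
    (h33 : ∀ x ν, lo ≤ x → x + e ν ≤ hi → ‖((V x ν * (avgIter L U k x ν)⁻¹ : 𝔸ˣ) : 𝔸) - 1‖ < 2 * δk)
    (n : ℕ) (hn : n ≤ k) (x : Site d) (ν : Fin d) (hx : tlo L lo n ≤ x) (hxν : x + e ν ≤ thi L hi n) :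
    ‖mlog (((pullIter L V n x ν * (avgIter L U (k - n) x ν)⁻¹ : 𝔸ˣ) : 𝔸))‖ ≤
        2 * (2 * δk + 8 * (d : ℝ) ^ 2 * α * ∑ m ∈ Finset.range n, (((L : ℝ) ^ m)⁻¹) ^ 2) ∧
      2 * (2 * δk + 8 * (d : ℝ) ^ 2 * α * ∑ m ∈ Finset.range n, (((L : ℝ) ^ m)⁻¹) ^ 2) <
        4 * δk + 22 * (d : ℝ) ^ 2 * α := by
  have hL' : (0 : ℝ) < L := by exact_mod_cast lt_of_lt_of_le (by norm_num) hL
  have hdiv : α / (L : ℝ) ^ 2 * (L : ℝ) ^ 2 = α := div_mul_cancel₀ _ (pow_ne_zero 2 hL'.ne')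
  have hβ : 0 < α / (L : ℝ) ^ 2 := by positivity
  have hα3' : C0 d * (α / (L : ℝ) ^ 2 * (L : ℝ) ^ 2) ≤ 1 / 3 := by rw [hdiv]; exact hα3
  have hα2' : 2 * (α / (L : ℝ) ^ 2 * (L : ℝ) ^ 2) ≤ c2' d L := by rw [hdiv]; exact hα2
  have h17' : pdev U < α / (L : ℝ) ^ 2 * (L : ℝ) ^ 2 * (((L : ℝ) ^ k)⁻¹) ^ 2 := by rwa [hdiv]
  have hmemG := (ineq128_global L hL hG k U hU hβ hα3' hα2' h17' 0 (Nat.zero_le k)).2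
  have hA : ∀ x μ, avgIter L U k x μ ∈ U1 𝔸 := fun x μ => hG.le_U1 (hmemG k (by simp) x μ)
  have htop : ∀ x ν, lo ≤ x → x + e ν ≤ hi → ‖((avgIter L U k x ν : 𝔸ˣ) : 𝔸) - V x ν‖ ≤ 2 * δk :=
    fun x ν hx' hxν' => top_sub_le_of_eq33 (hA x ν) (h33 x ν hx' hxν')
  obtain ⟨_, h2, h3⟩ := norm_argField_le L hL hd hG k U hU hα hα3 hα2 h32 V hV (by positivity : (0:ℝ) ≤ 2 * δk)
    hs lo hi h15 htop n hn x ν hx hxν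
  exact ⟨h2, by linarith⟩

/-- **[III] p. 266 WITH THE PRINTED CONSTANT `30d²L²B₃(1+β₀)ε_k`.**  The derived bound `4δ_k + 22d²α` with print's
located data — (3.2) for `U = U_{k+1,□′}`: `|U_{k+1,□′}(∂p) − 1| < ε_{k+1}(L⁻¹η)²` (`α = ε_{k+1}L⁻²`), (2.8):
`ε_{k+1} ≤ (1+β₀)ε_k`, and *"for A₁/A₀ … sufficiently small"* as `δ_k ≤ ε_k` (`δ_k = (A₁/A₀)ε_k`, p. 265), `B₃ ≥ 1`,
`β₀ ≥ 0` — is majorised by print's: `4δ_k + 22d²ε_{k+1}L⁻² ≤ 8d²L²B₃(1+β₀)ε_k + 22d²L²B₃(1+β₀)ε_k = 30d²L²B₃(1+β₀)ε_k`.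
So the field on the layer IS bounded by `30d²L²B₃(1+β₀)ε_k`, as printed (print's constant is not claimed sharp).
Smallness stated on `ε_{k+1}` (stronger than needed: `C₀ε_{k+1} ≤ ⅓`, `2ε_{k+1} ≤ c₂′`, `2δ_k + 11d²ε_{k+1} ≤ 1/6`).
[cite: Balaban1988Convergent, p.266 (after (3.6))] -/
theorem argField36_lt_printed (L : ℕ) (hL : 2 ≤ L) (hd : 1 ≤ d) {G : Subgroup 𝔸ˣ} (hG : AvgClosed d L G)
    (k : ℕ) (U : Site d → Fin d → 𝔸ˣ) (hU : ∀ x κ, U x κ ∈ G) {εk εk1 δk B₃ β₀ : ℝ} (hε : 0 < εk)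
    (hε1 : 0 < εk1) (h28 : εk1 ≤ (1 + β₀) * εk) (hβ₀ : 0 ≤ β₀) (hB₃ : 1 ≤ B₃) (hδ : 0 ≤ δk) (hδε : δk ≤ εk)
    (hs3 : C0 d * εk1 ≤ 1 / 3) (hs2 : 2 * εk1 ≤ c2' d L) (hs : 2 * δk + 11 * (d : ℝ) ^ 2 * εk1 ≤ 1 / 6)
    (h32 : pdev U < εk1 * ((L : ℝ)⁻¹ * ((L : ℝ) ^ k)⁻¹) ^ 2)
    (V : Site d → Fin d → 𝔸ˣ) (hV : ∀ x μ, V x μ ∈ U1 𝔸) (lo hi : Site d)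
    (h15 : ∀ n, n < k → ∀ z, tlo L lo n ≤ z → z ≤ thi L hi n → ∀ r : Fin d → Fin L,
      axialFn (avgIter L U (k - (n + 1))) ((L : ℤ) • z) ((L : ℤ) • z + boxVec L r) = 1)
    (h33 : ∀ x ν, lo ≤ x → x + e ν ≤ hi → ‖((V x ν * (avgIter L U k x ν)⁻¹ : 𝔸ˣ) : 𝔸) - 1‖ < 2 * δk)
    (n : ℕ) (hn : n ≤ k) (x : Site d) (ν : Fin d) (hx : tlo L lo n ≤ x) (hxν : x + e ν ≤ thi L hi n) :
    ‖mlog (((pullIter L V n x ν * (avgIter L U (k - n) x ν)⁻¹ : 𝔸ˣ) : 𝔸))‖ <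
      30 * (d : ℝ) ^ 2 * (L : ℝ) ^ 2 * B₃ * (1 + β₀) * εk := by
  have hL' : (2 : ℝ) ≤ L := by exact_mod_cast hL
  have hLpos : (0 : ℝ) < L := by linarith
  have hd' : (1 : ℝ) ≤ d := by exact_mod_cast hd
  have hL2 : (1 : ℝ) ≤ (L : ℝ) ^ 2 := by nlinarith
  have hd2 : (1 : ℝ) ≤ (d : ℝ) ^ 2 := by nlinarith
  -- `α = ε_{k+1}L⁻²`
  have hαpos : 0 < εk1 / (L : ℝ) ^ 2 := by positivity
  have hαle : εk1 / (L : ℝ) ^ 2 ≤ εk1 := div_le_self hε1.le hL2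
  have hα3 : C0 d * (εk1 / (L : ℝ) ^ 2) ≤ 1 / 3 := (mul_le_mul_of_nonneg_left hαle (C0_pos d).le).trans hs3
  have hα2 : 2 * (εk1 / (L : ℝ) ^ 2) ≤ c2' d L := by linarith
  have h11 : 11 * (d : ℝ) ^ 2 * (εk1 / (L : ℝ) ^ 2) ≤ 11 * (d : ℝ) ^ 2 * εk1 :=
    mul_le_mul_of_nonneg_left hαle (by positivity)
  have hsα : 2 * δk + 11 * (d : ℝ) ^ 2 * (εk1 / (L : ℝ) ^ 2) ≤ 1 / 6 := by linarith
  have heq : εk1 * ((L : ℝ)⁻¹ * ((L : ℝ) ^ k)⁻¹) ^ 2 = εk1 / (L : ℝ) ^ 2 * (((L : ℝ) ^ k)⁻¹) ^ 2 := by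
    rw [mul_pow, inv_pow, div_eq_mul_inv]; ring
  have h32' : pdev U < εk1 / (L : ℝ) ^ 2 * (((L : ℝ) ^ k)⁻¹) ^ 2 := heq ▸ h32
  obtain ⟨h1, h2⟩ := argField36_lt L hL hd hG k U hU hαpos hα3 hα2 h32' V hV hδ hsα lo hi h15 h33 n hn x ν hx hxν
  -- `4δ_k + 22d²ε_{k+1}L⁻² ≤ 30d²L²B₃(1+β₀)ε_k`: both terms against the monomial `P·ε_k`, `P = d²L²B₃(1+β₀) ≥ 1`
  have hP1 : (1 : ℝ) ≤ (d : ℝ) ^ 2 * (L : ℝ) ^ 2 * B₃ * (1 + β₀) := by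
    have h1' : (1 : ℝ) ≤ (d : ℝ) ^ 2 * (L : ℝ) ^ 2 := one_le_mul_of_one_le_of_one_le hd2 hL2
    have h2' : (1 : ℝ) ≤ (d : ℝ) ^ 2 * (L : ℝ) ^ 2 * B₃ := one_le_mul_of_one_le_of_one_le h1' hB₃
    exact one_le_mul_of_one_le_of_one_le h2' (by linarith)
  have hPε : εk ≤ (d : ℝ) ^ 2 * (L : ℝ) ^ 2 * B₃ * (1 + β₀) * εk := le_mul_of_one_le_left hε.le hP1
  have hA : 4 * δk ≤ 8 * ((d : ℝ) ^ 2 * (L : ℝ) ^ 2 * B₃ * (1 + β₀) * εk) := by linarith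
  have hq : (d : ℝ) ^ 2 * ((1 + β₀) * εk) ≤ (d : ℝ) ^ 2 * (L : ℝ) ^ 2 * B₃ * (1 + β₀) * εk := by
    have hLB : (1 : ℝ) ≤ (L : ℝ) ^ 2 * B₃ := one_le_mul_of_one_le_of_one_le hL2 hB₃
    have h0 : 0 ≤ (d : ℝ) ^ 2 * ((1 + β₀) * εk) := by positivity
    calc (d : ℝ) ^ 2 * ((1 + β₀) * εk) ≤ (d : ℝ) ^ 2 * ((1 + β₀) * εk) * ((L : ℝ) ^ 2 * B₃) :=
        le_mul_of_one_le_right h0 hLB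
      _ = (d : ℝ) ^ 2 * (L : ℝ) ^ 2 * B₃ * (1 + β₀) * εk := by ring
  have hB : 22 * (d : ℝ) ^ 2 * (εk1 / (L : ℝ) ^ 2) ≤ 22 * ((d : ℝ) ^ 2 * (L : ℝ) ^ 2 * B₃ * (1 + β₀) * εk) := by
    have hα1 : εk1 / (L : ℝ) ^ 2 ≤ (1 + β₀) * εk := hαle.trans h28
    have h3 : (d : ℝ) ^ 2 * (εk1 / (L : ℝ) ^ 2) ≤ (d : ℝ) ^ 2 * ((1 + β₀) * εk) :=
      mul_le_mul_of_nonneg_left hα1 (by positivity)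
    linarith
  calc ‖mlog (((pullIter L V n x ν * (avgIter L U (k - n) x ν)⁻¹ : 𝔸ˣ) : 𝔸))‖
      < 4 * δk + 22 * (d : ℝ) ^ 2 * (εk1 / (L : ℝ) ^ 2) := h1.trans_lt h2
    _ ≤ 30 * (d : ℝ) ^ 2 * (L : ℝ) ^ 2 * B₃ * (1 + β₀) * εk := by linarith

omit [NormedAlgebra ℂ 𝔸] [CompleteSpace 𝔸] in
/-- (3.3) is invariant under a simultaneous gauge transformation of `V_k` and `V_{□′}^{(k)}` by a unit-norm-valued `w`:
`V_k^w(b)(V_{□′}^{(k)w}(b))⁻¹ = w(b₋)[V_k(b)(V_{□′}^{(k)}(b))⁻¹]w(b₋)⁻¹` ((8)/(45) of [12]: conjugation does not change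
`|· − 1|`, `B7AvgGaugeCovariance.norm_conj_sub_one_eq`). [cite: Balaban1988Convergent, (3.3) p.265] -/
theorem norm_ratio_gaugeAct_sub_one {w : Site d → 𝔸ˣ} (hw : ∀ x, w x ∈ U1 𝔸) (V A : Site d → Fin d → 𝔸ˣ)
    (x : Site d) (ν : Fin d) :
    ‖((gaugeAct w V x ν * (gaugeAct w A x ν)⁻¹ : 𝔸ˣ) : 𝔸) - 1‖ = ‖((V x ν * (A x ν)⁻¹ : 𝔸ˣ) : 𝔸) - 1‖ := by
  have h : gaugeAct w V x ν * (gaugeAct w A x ν)⁻¹ = w x * (V x ν * (A x ν)⁻¹) * (w x)⁻¹ := by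
    show w x * V x ν * (w (x + e ν))⁻¹ * (w x * A x ν * (w (x + e ν))⁻¹)⁻¹ = _
    group
  rw [h]
  exact norm_conj_sub_one_eq (hw x)

/-- **[III] p. 266 FOR EVERY ORBIT** — the `30d²L²B₃(1+β₀)ε_k` bound for the block-axial representative: for EVERY
`G`-valued `U = U_{k+1,□′}` with (3.2) and every `G`-valued `V = V_k` with (3.3) against `M^k(U)` on `[lo, hi]`, the
pair `U′ = U^{u}`, `V′ = V^{u↾T^{(k)}}`, `u = towerGauge L U k lo` ([14] p. 78: the gauge exists; (3.2), (3.3) are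
invariant — `pdev_gaugeAct`, `norm_ratio_gaugeAct_sub_one` with `M^k(U^u) = M^k(U)^{u↾T^{(k)}}`, (14) of [12]) has
`U′` in the axial gauge in blocks and satisfies the conclusion of `argField36_lt_printed` — the argument field of
(3.6) is a statement about this representative, the compensating `u` being absorbed in `u_{k,□}`.
[cite: Balaban1988Convergent, p.266 (after (3.6))] -/
theorem argField36_lt_printed_orbit (L : ℕ) (hL : 2 ≤ L) (hd : 1 ≤ d) {G : Subgroup 𝔸ˣ} (hG : AvgClosed d L G)
    (k : ℕ) (U : Site d → Fin d → 𝔸ˣ) (hU : ∀ x κ, U x κ ∈ G) {εk εk1 δk B₃ β₀ : ℝ} (hε : 0 < εk)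
    (hε1 : 0 < εk1) (h28 : εk1 ≤ (1 + β₀) * εk) (hβ₀ : 0 ≤ β₀) (hB₃ : 1 ≤ B₃) (hδ : 0 ≤ δk) (hδε : δk ≤ εk)
    (hs3 : C0 d * εk1 ≤ 1 / 3) (hs2 : 2 * εk1 ≤ c2' d L) (hs : 2 * δk + 11 * (d : ℝ) ^ 2 * εk1 ≤ 1 / 6)
    (h32 : pdev U < εk1 * ((L : ℝ)⁻¹ * ((L : ℝ) ^ k)⁻¹) ^ 2)
    (V : Site d → Fin d → 𝔸ˣ) (hV : ∀ x μ, V x μ ∈ G) (lo hi : Site d)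
    (h33 : ∀ x ν, lo ≤ x → x + e ν ≤ hi → ‖((V x ν * (avgIter L U k x ν)⁻¹ : 𝔸ˣ) : 𝔸) - 1‖ < 2 * δk)
    (n : ℕ) (hn : n ≤ k) (x : Site d) (ν : Fin d) (hx : tlo L lo n ≤ x) (hxν : x + e ν ≤ thi L hi n) :
    ‖mlog (((pullIter L (gaugeAct (uLev L (towerGauge L U k lo) k) V) n x ν *
        (avgIter L (gaugeAct (towerGauge L U k lo) U) (k - n) x ν)⁻¹ : 𝔸ˣ) : 𝔸))‖ <
      30 * (d : ℝ) ^ 2 * (L : ℝ) ^ 2 * B₃ * (1 + β₀) * εk := by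
  have hL' : (2 : ℝ) ≤ L := by exact_mod_cast hL
  have hLpos : (0 : ℝ) < L := by linarith
  have hL2 : (1 : ℝ) ≤ (L : ℝ) ^ 2 := by nlinarith
  -- the gauge exists (Prop.-1/2-smallness of `ε_{k+1}L⁻²` in the form `gaugeFix_global` wants)
  have hαle : εk1 / (L : ℝ) ^ 2 ≤ εk1 := div_le_self hε1.le hL2
  have hdiv : εk1 / (L : ℝ) ^ 2 / (L : ℝ) ^ 2 * (L : ℝ) ^ 2 = εk1 / (L : ℝ) ^ 2 :=
    div_mul_cancel₀ _ (pow_ne_zero 2 hLpos.ne')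
  have hβ : 0 < εk1 / (L : ℝ) ^ 2 / (L : ℝ) ^ 2 := by positivity
  have hα3' : C0 d * (εk1 / (L : ℝ) ^ 2 / (L : ℝ) ^ 2 * (L : ℝ) ^ 2) ≤ 1 / 3 := by
    rw [hdiv]; exact (mul_le_mul_of_nonneg_left hαle (C0_pos d).le).trans hs3
  have hα2' : 2 * (εk1 / (L : ℝ) ^ 2 / (L : ℝ) ^ 2 * (L : ℝ) ^ 2) ≤ c2' d L := by rw [hdiv]; linarith
  have heq : εk1 * ((L : ℝ)⁻¹ * ((L : ℝ) ^ k)⁻¹) ^ 2 = εk1 / (L : ℝ) ^ 2 * (((L : ℝ) ^ k)⁻¹) ^ 2 := by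
    rw [mul_pow, inv_pow, div_eq_mul_inv]; ring
  have h17' : pdev U < εk1 / (L : ℝ) ^ 2 / (L : ℝ) ^ 2 * (L : ℝ) ^ 2 * (((L : ℝ) ^ k)⁻¹) ^ 2 := by
    rw [hdiv, ← heq]; exact h32
  obtain ⟨huG, hU'G, hpdev, hcov, h15, _⟩ := gaugeFix_global L hL hG k U hU hβ hα3' hα2' h17' lo
  have hw : ∀ x, uLev L (towerGauge L U k lo) k x ∈ U1 𝔸 := fun x => by
    rw [uLev_apply]; exact hG.le_U1 (huG _)
  have h32' : pdev (gaugeAct (towerGauge L U k lo) U) < εk1 * ((L : ℝ)⁻¹ * ((L : ℝ) ^ k)⁻¹) ^ 2 := by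
    rw [hpdev]; exact h32
  have hV' : ∀ x μ, gaugeAct (uLev L (towerGauge L U k lo) k) V x μ ∈ U1 𝔸 := fun x μ =>
    gaugeAct_mem_of (fun x κ => hG.le_U1 (hV x κ)) hw x μ
  have h33' : ∀ x ν, lo ≤ x → x + e ν ≤ hi →
      ‖((gaugeAct (uLev L (towerGauge L U k lo) k) V x ν *
        (avgIter L (gaugeAct (towerGauge L U k lo) U) k x ν)⁻¹ : 𝔸ˣ) : 𝔸) - 1‖ < 2 * δk := fun x ν hx' hxν' => by
    rw [hcov k le_rfl, norm_ratio_gaugeAct_sub_one hw]; exact h33 x ν hx' hxν'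
  exact argField36_lt_printed L hL hd hG k _ hU'G hε hε1 h28 hβ₀ hB₃ hδ hδε hs3 hs2 hs h32' _ hV' lo hi
    (fun n hn z _ _ r => h15 n hn z r) h33' n hn x ν hx hxν

end Eq36


/-! ## §2 The twin passage of [IV] = [Balaban1989LargeFieldI] p. 185–186: the located sizes `4δ′_j`, `22d²ε_j`,
`22d²ε_{j+1}` of the argument field of (1.34)/(1.38), and `4δ′_j` of (1.44)/(1.45) -/

section LF185

variable {𝔸 : Type*} [NormedRing 𝔸] [NormOneClass 𝔸] [NormedAlgebra ℂ 𝔸] [CompleteSpace 𝔸]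

omit [NormOneClass 𝔸] in
/-- **[IV] p. 185, "the field is equal to (1/i)log[V_j(V_Z^{(j)})⁻¹], hence it can be bounded by 4δ′_j, as it follows from
the restrictions in (1.27)"** and **p. 186 (1.45), "The field in the argument of the function ℍ^{(n)}_k is bounded by 4δ′_j"**
((1.44): the argument IS `(1/i)log[V_j(V_Z^{(j)})⁻¹]`): per bond, (1.27) `|V_j(b)(V_Z^{(j)}(b))⁻¹ − 1| < 2δ′_j` and (26) of [12]
give `|(1/i)log[V_j(b)(V_Z^{(j)}(b))⁻¹]| < 4δ′_j` (for `2δ′_j ≤ ½`) — the B-size `hm`/`hm₁` of r12's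
`B15HDecayLeaves.ineq145_of_ineq190` / `ineq138_first_of_ineq190`; `A = V_Z^{(j)}(b)`, `V = V_j(b)`.
[cite: Balaban1989LargeFieldI, p.185 (before (1.38)), (1.45) p.186] -/
theorem argField145_lt (A V : 𝔸ˣ) {δ'j : ℝ} (hδ : 2 * δ'j ≤ 1 / 2) (h127 : ‖((V * A⁻¹ : 𝔸ˣ) : 𝔸) - 1‖ < 2 * δ'j) :
    ‖mlog (((V * A⁻¹ : 𝔸ˣ) : 𝔸))‖ < 4 * δ'j :=
  argField36_top_lt A V hδ h127

/-- **[IV] p. 185, the `Ω^c_j ∩ Z^c_j` part of the argument field of (1.34)**: *"on the domain Ω^c_j∩Z^c_j, except a boundary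
layer of the width 2M₁ at the boundary ∂Z^c_j, the field is equal to (1/i)log[V_j(V_Z^{(j)})⁻¹], hence it can be bounded by
4δ′_j, as it follows from the restrictions in (1.27). On the boundary layer it can be bounded by 22d²ε_j."*  On the `ℤ^d`
carriers: `U = U_k^{(n+1)}` with (1.24) (`c = 1`) on this domain in the global sup form `pdev U < ε_jξ²`, `ξ = L^{−j}`, the top
field `V = V_j` with (1.27) `|V_j(b)(V_Z^{(j)}(b))⁻¹ − 1| < 2δ′_j`, `V_Z^{(j)} = M^j(U)` ((1.26)/(1.53)), on every bond of the top
cube, `U` in the axial gauge in blocks on the cube tower: by `B15Layer130Lattice.norm_argField_le` with top discrepancy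
`α₁ = 2δ′_j`, at every depth `n ≥ 0` and bond of the depth-`n` cube the field `−(1/i)log[M^{j−n}(U)(b)((Q^{s*}_nV_j)(b))⁻¹]` is
`≤ 4δ′_j + (64/3)d²ε_j`, hence `≤ 22d²ε_j` — print's number (*"can be bounded by"*) — under the located clause `6δ′_j ≤ ε_j`
(p. 184: *"From the restrictions (1.27) we get the bound O(1)δ′_j < ε_j"*; `d ≥ 1`; the slack `22 − 64/3 = 2/3` of [14]'s `11`
is exactly `4δ′_j ≤ (2/3)d²ε_j`, so the bound is `≤`, the form of the B-size hypothesis `hm₃` of r12's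
`B15HDecayLeaves.ineq138_first_of_ineq190`).  Both ratio orders. [cite: Balaban1989LargeFieldI, p.185 (before (1.38))] -/
theorem layer138_Zc_lt (L : ℕ) (hL : 2 ≤ L) (hd : 1 ≤ d) {G : Subgroup 𝔸ˣ} (hG : AvgClosed d L G)
    (j : ℕ) (U : Site d → Fin d → 𝔸ˣ) (hU : ∀ x κ, U x κ ∈ G) {εj δ'j : ℝ} (hε : 0 < εj) (hε3 : C0 d * εj ≤ 1 / 3)
    (hε2 : 2 * εj ≤ c2' d L) (h124 : pdev U < εj * (((L : ℝ) ^ j)⁻¹) ^ 2)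
    (V : Site d → Fin d → 𝔸ˣ) (hV : ∀ x μ, V x μ ∈ U1 𝔸) (hδ : 0 ≤ δ'j) (hδε : 6 * δ'j ≤ εj)
    (hs : 2 * δ'j + 11 * (d : ℝ) ^ 2 * εj ≤ 1 / 6) (lo hi : Site d)
    (h15 : ∀ n, n < j → ∀ z, tlo L lo n ≤ z → z ≤ thi L hi n → ∀ r : Fin d → Fin L,
      axialFn (avgIter L U (j - (n + 1))) ((L : ℤ) • z) ((L : ℤ) • z + boxVec L r) = 1)
    (h127 : ∀ x ν, lo ≤ x → x + e ν ≤ hi → ‖((V x ν * (avgIter L U j x ν)⁻¹ : 𝔸ˣ) : 𝔸) - 1‖ < 2 * δ'j)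
    (n : ℕ) (hn : n ≤ j) (x : Site d) (ν : Fin d) (hx : tlo L lo n ≤ x) (hxν : x + e ν ≤ thi L hi n) :
    ‖mlog (((avgIter L U (j - n) x ν * (pullIter L V n x ν)⁻¹ : 𝔸ˣ) : 𝔸))‖ ≤ 22 * (d : ℝ) ^ 2 * εj ∧
      ‖mlog (((pullIter L V n x ν * (avgIter L U (j - n) x ν)⁻¹ : 𝔸ˣ) : 𝔸))‖ ≤ 22 * (d : ℝ) ^ 2 * εj := by
  have hL' : (0 : ℝ) < L := by exact_mod_cast lt_of_lt_of_le (by norm_num) hL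
  have hdiv : εj / (L : ℝ) ^ 2 * (L : ℝ) ^ 2 = εj := div_mul_cancel₀ _ (pow_ne_zero 2 hL'.ne')
  have hβ : 0 < εj / (L : ℝ) ^ 2 := by positivity
  have hα3' : C0 d * (εj / (L : ℝ) ^ 2 * (L : ℝ) ^ 2) ≤ 1 / 3 := by rw [hdiv]; exact hε3
  have hα2' : 2 * (εj / (L : ℝ) ^ 2 * (L : ℝ) ^ 2) ≤ c2' d L := by rw [hdiv]; exact hε2
  have h17' : pdev U < εj / (L : ℝ) ^ 2 * (L : ℝ) ^ 2 * (((L : ℝ) ^ j)⁻¹) ^ 2 := by rwa [hdiv]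
  have hmemG := (ineq128_global L hL hG j U hU hβ hα3' hα2' h17' 0 (Nat.zero_le j)).2
  have hA : ∀ x μ, avgIter L U j x μ ∈ U1 𝔸 := fun x μ => hG.le_U1 (hmemG j (by simp) x μ)
  have htop : ∀ x ν, lo ≤ x → x + e ν ≤ hi → ‖((avgIter L U j x ν : 𝔸ˣ) : 𝔸) - V x ν‖ ≤ 2 * δ'j :=
    fun x ν hx' hxν' => top_sub_le_of_eq33 (hA x ν) (h127 x ν hx' hxν')
  obtain ⟨h1, h2, _⟩ := norm_argField_le L hL hd hG j U hU hε hε3 hε2 h124 V hV (by positivity : (0:ℝ) ≤ 2 * δ'j)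
    hs lo hi h15 htop n hn x ν hx hxν
  -- `2(2δ′_j + 8d²ε_jΣ) ≤ 4δ′_j + (64/3)d²ε_j < 22d²ε_j` under `6δ′_j ≤ ε_j ≤ d²ε_j`
  have hS := geom_sum_le hL n
  have hd' : (1 : ℝ) ≤ d := by exact_mod_cast hd
  have hd2 : (1 : ℝ) ≤ (d : ℝ) ^ 2 := by nlinarith
  have hεd : εj ≤ (d : ℝ) ^ 2 * εj := le_mul_of_one_le_left hε.le hd2
  have hsum : 8 * (d : ℝ) ^ 2 * εj * ∑ m ∈ Finset.range n, (((L : ℝ) ^ m)⁻¹) ^ 2 ≤ 8 * (d : ℝ) ^ 2 * εj * (4 / 3) :=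
    mul_le_mul_of_nonneg_left hS (by positivity)
  have hkey : 2 * (2 * δ'j + 8 * (d : ℝ) ^ 2 * εj * ∑ m ∈ Finset.range n, (((L : ℝ) ^ m)⁻¹) ^ 2) ≤
      22 * (d : ℝ) ^ 2 * εj := by linarith
  exact ⟨h1.trans hkey, h2.trans hkey⟩

/-- **[IV] p. 185, the `Ω_{j+1} ∩ Z_{j+1}` part of the argument field of (1.34)**: *"On the domain Ω_{j+1}∩Z_{j+1}, except a
boundary layer of the width 2LM₁ at the boundary ∂Z_{j+1}, this field is equal to 0. On the boundary layer it can be bounded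
by 22d²ε_{j+1}"* — there the comparison configuration is `Q^{s*}_{j+1}V_{j+1}` (p. 184) and `M^{j+1}(U_k^{(n+1)}) = V_{j+1}` (the
constraints (1.18)), so this is `B15Layer130Lattice.argField_top_eq_zero` / `layer130_lt` one scale up (`j ↦ j + 1`, (1.24) with
`c = 1` on `Ω_j∖Ω_{j+2}`): restated under print's letters. [cite: Balaban1989LargeFieldI, p.185 (before (1.38))] -/
theorem layer138_Z_lt (L : ℕ) (hL : 2 ≤ L) (hd : 1 ≤ d) {G : Subgroup 𝔸ˣ} (hG : AvgClosed d L G)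
    (j : ℕ) (U : Site d → Fin d → 𝔸ˣ) (hU : ∀ x κ, U x κ ∈ G) {β εj1 : ℝ} (hβ : 0 ≤ β) (hε : 0 < εj1)
    (hε3 : C0 d * εj1 ≤ 1 / 3) (hε2 : 2 * εj1 ≤ c2' d L) (hεs : 11 * (d : ℝ) ^ 2 * εj1 ≤ 1 / 6)
    (h124 : pdev U < (1 - β * (1 / 2)) * εj1 * (((L : ℝ) ^ (j + 1))⁻¹) ^ 2) (lo hi : Site d)
    (h15 : ∀ n, n < j + 1 → ∀ z, tlo L lo n ≤ z → z ≤ thi L hi n → ∀ r : Fin d → Fin L,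
      axialFn (avgIter L U (j + 1 - (n + 1))) ((L : ℤ) • z) ((L : ℤ) • z + boxVec L r) = 1)
    (n : ℕ) (hn : n ≤ j + 1) (x : Site d) (ν : Fin d) (hx : tlo L lo n ≤ x) (hxν : x + e ν ≤ thi L hi n) :
    mlog (((avgIter L U (j + 1) x ν * (pullIter L (avgIter L U (j + 1)) 0 x ν)⁻¹ : 𝔸ˣ) : 𝔸)) = 0 ∧
      ‖mlog (((avgIter L U (j + 1 - n) x ν * (pullIter L (avgIter L U (j + 1)) n x ν)⁻¹ : 𝔸ˣ) : 𝔸))‖ <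
        22 * (d : ℝ) ^ 2 * εj1 :=
  ⟨(argField_top_eq_zero L U (j + 1) x ν).1,
    layer130_lt L hL hd hG (j + 1) U hU hβ hε hε3 hε2 hεs h124 lo hi h15 n hn x ν hx hxν⟩

end LF185

end Literature.MathematicalPhysics.QuantumFieldTheory.Balaban1983to89.B14ArgField36Lattice
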